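import Summits.Ventures.CertifiedArithmetic.LowPrec.DoubleRoundingSlipWide

/-!
# Double rounding of quotients (THEOREM D-div, every pair of records)

HONEST FRAMING: certified error envelopes and provably optimal rounding/accumulation schemes for
low-precision formats under stated cost models; every table by two implementations; no hardware
or vendor claims.

`fl_φ (fl_ψ (a / b)) = fl_φ (a / b)` for all finite `a b` of `φ`: ONE division executed (correctly
rounded) in the wider format `ψ` and converted to `φ` is the correctly rounded quotient of `φ`
(both roundings the saturating round-to-nearest-even `roundNE` of this packet, subnormals kept;
`a / 0 = 0` in `ℚ`, so the divisor needs no hypothesis).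

## THE QUOTIENT CLAUSE (Q) — `drDiv_of_clause`, for EVERY pair of format records

If `F_φ ⊆ F_ψ` (`embedsTest`), `P_ψ ≥ 2 P_φ` (`2·m_φ + 1 ≤ m_ψ`), `L_ψ + P_φ ≤ L_φ`
(`qexp ψ + m_φ + 1 ≤ qexp φ`: half a quantum of `φ` is at least `2^P_φ` quanta of `ψ`) and
`m_φ ≥ 1`, then the double rounding of every quotient is innocuous. No bias hypothesis: the
P3109 `binary8p3` records (bias 16) divide correctly through `binary16` (bias 15).

ANATOMY OF A SLIP (the proof; `div_slip_core` is its integer heart). A slip at `x = a/b > 0`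
forces (`slip_midpoint_of_pos_of_qexp_lt` of `DoubleRoundingSlipWide.lean`, Property 2.1 without
the bias hypothesis) `fl_ψ x = m`, the midpoint of two neighbours `v < u` of `φ`, `x ≠ m`. In
units `ν = ½ quantum ψ` (`2^W ν = 1`):
`m = M ν`, `M = (2V+1)·2^g`, `v = 2V·2^g ν`; `|x - m| ≤ 2^t ν` with `2^t ν` half an ulp of `ψ` at
`m` (`t = expCode - 1`, also for a SUBNORMAL `m`, `abs_sub_roundNE_le_half_ulp_of_pos`); the
significands `A = 2^α A₁`, `B = 2^β B₁` (odd parts `< 2^P_φ`) give the nonzero integer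
`N = 2^(α+W) A₁ - M·2^β B₁ = B·(x - m)/ν`, `|N| ≤ 2^(t+β) B₁`. Binade bookkeeping gives
`g ≥ t + P_φ` (from `P_ψ ≥ 2 P_φ` when `m` is normal in `ψ`, from `L_ψ + P_φ ≤ L_φ` when it is
subnormal, `t = 0`). If `2^(g+β) ∣ N` then `2^g ≤ 2^t B₁ < 2^(t+P_φ)`; otherwise
`N = 2^(α+W)·odd` and `2^g ν < x` (i.e. `2^(g+β) B₁ < 2^(α+W) A₁`, true unless `v = 0` and
`x < m = quantum_φ/2`, where both routes give `0` by the tie-to-even) squeeze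
`2^(α+W+c) ≤ 2^(t+β) B₁ 2^c < 2^(t+β+P_φ)` with `g + β = α + W + c` — either way `g < t + P_φ`.
Signs go by the oddness of `roundNE`; `a = 0` or `b = 0` give `x = 0`.

The named `13 × 13` matrix (clause cells, one kernel-checked witness per failing embedded cell,
sharpness of the underflow clause) is `DoubleRoundingDivisionMatrix.lean`; implementation A is
`code/enum/doublediv_decision.py` → `DOUBLE-ROUNDING-DIV.md`. PLACEMENT: innocuous double
rounding of quotients for `p₂ ≥ 2p₁` with unbounded exponents, and its optimality, is
[Figueroa1995, §3]; [Roux2014, Thm 29, Table II] formalises it (Coq/Flocq, any tie rule, no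
overflow) with gradual underflow under `emin₂ ≤ emin₁ - p₁ - 2`. The clause here is specific to
ties-to-even and to the saturating records of this packet, and its underflow hypothesis
`L_ψ ≤ L_φ - P_φ` is weaker by two; `DoubleRoundingDivisionMatrix.lean` shows `L_ψ = L_φ - P_φ + 1`
fails. We found no statement of the finite matrix in the literature searched (queries in the
cell's notes). No hardware or vendor claims.
-/

namespace Summit.Ventures.CertifiedArithmetic

open Literature.ComputerArithmetic.FloatingPoint
open Literature.ComputerArithmetic.FloatingPoint.Format
open Literature.ComputerArithmetic.FloatingPoint.MiniFloat

/-! ## §1 The integer heart -/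

/-- THE INTEGER HEART OF THEOREM D-div. With `A₁` odd, `A₁, B₁ < 2^p`, `t + p ≤ g`: the integer
`N = 2^(α+W) A₁ - (2V+1) 2^(g+β) B₁` cannot be nonzero, at most `2^(t+β) B₁` in absolute value,
and have `2^(g+β) B₁ < 2^(α+W) A₁`. [this packet] -/
theorem div_slip_core {p α β W g t V A₁ B₁ : ℕ} (hA₁ : Odd A₁) (hA₁lt : A₁ < 2 ^ p)
    (hB₁lt : B₁ < 2 ^ p) (hg : t + p ≤ g)
    (hN0 : (2:ℤ) ^ (α + W) * A₁ - (2 * V + 1) * 2 ^ (g + β) * B₁ ≠ 0)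
    (hNle : |(2:ℤ) ^ (α + W) * A₁ - (2 * V + 1) * 2 ^ (g + β) * B₁| ≤ 2 ^ (t + β) * B₁)
    (hmx : (2:ℤ) ^ (g + β) * B₁ < 2 ^ (α + W) * A₁) : False := by
  have two_pow_lt : ∀ {i j : ℕ}, (2:ℤ) ^ i < 2 ^ j → i < j := fun h =>
    (pow_lt_pow_iff_right₀ (by norm_num : (1:ℤ) < 2)).mp h
  have hB₁' : (B₁ : ℤ) < 2 ^ p := by exact_mod_cast hB₁lt
  have hA₁' : (A₁ : ℤ) < 2 ^ p := by exact_mod_cast hA₁lt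
  obtain ⟨r, hr⟩ := hA₁
  have hr' : (A₁ : ℤ) = 2 * r + 1 := by rw [hr]; push_cast; ring
  rcases Nat.lt_or_ge (α + W) (g + β) with hlt | hge
  · -- `g + β = α + W + (c+1)`: `N = 2^(α+W) · K` with `K` odd
    obtain ⟨c, hc⟩ : ∃ c, g + β = α + W + (c + 1) := ⟨g + β - (α + W) - 1, by omega⟩
    set K : ℤ := (A₁ : ℤ) - (2 * V + 1) * 2 ^ (c + 1) * B₁ with hK
    have hNK : (2:ℤ) ^ (α + W) * A₁ - (2 * V + 1) * 2 ^ (g + β) * B₁ = 2 ^ (α + W) * K := by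
      rw [hK, hc, pow_add]; ring
    have hK0 : K ≠ 0 := by
      rw [hK, hr', pow_succ]
      set E : ℤ := (2 * V + 1) * (2 ^ c) * B₁ with hE
      have e : (2 * (r : ℤ) + 1) - (2 * V + 1) * (2 ^ c * 2) * B₁ = 2 * (r - E) + 1 := by
        rw [hE]; ring
      rw [e]; omega
    have hK1 : 1 ≤ |K| := Int.one_le_abs hK0
    have hcB : (2:ℤ) ^ (c + 1) * B₁ < 2 ^ p := by
      have h1 : (2:ℤ) ^ (α + W) * (2 ^ (c + 1) * B₁) < 2 ^ (α + W) * A₁ := by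
        calc (2:ℤ) ^ (α + W) * (2 ^ (c + 1) * B₁) = 2 ^ (g + β) * B₁ := by rw [hc, pow_add]; ring
          _ < 2 ^ (α + W) * A₁ := hmx
      exact (lt_of_mul_lt_mul_left h1 (by positivity)).trans hA₁'
    have h3 : (2:ℤ) ^ (α + W + (c + 1)) < 2 ^ (t + β + p) := by
      calc (2:ℤ) ^ (α + W + (c + 1)) = 2 ^ (α + W) * 1 * 2 ^ (c + 1) := by rw [pow_add]; ring
        _ ≤ 2 ^ (α + W) * |K| * 2 ^ (c + 1) :=
            mul_le_mul_of_nonneg_right (mul_le_mul_of_nonneg_left hK1 (by positivity))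
              (by positivity)
        _ = |(2:ℤ) ^ (α + W) * A₁ - (2 * V + 1) * 2 ^ (g + β) * B₁| * 2 ^ (c + 1) := by
            rw [hNK, abs_mul, abs_of_pos (by positivity : (0:ℤ) < 2 ^ (α + W))]
        _ ≤ 2 ^ (t + β) * B₁ * 2 ^ (c + 1) := mul_le_mul_of_nonneg_right hNle (by positivity)
        _ = 2 ^ (t + β) * (2 ^ (c + 1) * B₁) := by ring
        _ < 2 ^ (t + β) * 2 ^ p := mul_lt_mul_of_pos_left hcB (by positivity)
        _ = 2 ^ (t + β + p) := by ring
    have := two_pow_lt h3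
    omega
  · -- `α + W = g + β + d`: `2^(g+β) ∣ N`
    obtain ⟨d, hd⟩ : ∃ d, α + W = g + β + d := ⟨α + W - (g + β), by omega⟩
    set K : ℤ := (2:ℤ) ^ d * A₁ - (2 * V + 1) * B₁ with hK
    have hNK : (2:ℤ) ^ (α + W) * A₁ - (2 * V + 1) * 2 ^ (g + β) * B₁ = 2 ^ (g + β) * K := by
      rw [hK, hd, pow_add]; ring
    have hK0 : K ≠ 0 := by intro h0; rw [hNK, h0, mul_zero] at hN0; exact hN0 rfl
    have hK1 : 1 ≤ |K| := Int.one_le_abs hK0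
    have h3 : (2:ℤ) ^ (g + β) < 2 ^ (t + β + p) := by
      calc (2:ℤ) ^ (g + β) = 2 ^ (g + β) * 1 := (mul_one _).symm
        _ ≤ 2 ^ (g + β) * |K| := mul_le_mul_of_nonneg_left hK1 (by positivity)
        _ = |(2:ℤ) ^ (α + W) * A₁ - (2 * V + 1) * 2 ^ (g + β) * B₁| := by
            rw [hNK, abs_mul, abs_of_pos (by positivity : (0:ℤ) < 2 ^ (g + β))]
        _ ≤ 2 ^ (t + β) * B₁ := hNle
        _ < 2 ^ (t + β) * 2 ^ p := mul_lt_mul_of_pos_left hB₁' (by positivity)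
        _ = 2 ^ (t + β + p) := by ring
    have := two_pow_lt h3
    omega

/-! ## §2 The quotient clause -/

/-- THEOREM D-div, positive operands: under the quotient clause a slip of `fl_φ ∘ fl_ψ` at
`x = a / b > 0` is impossible (the anatomy of the module docstring, reduced to `div_slip_core`).
[this packet; cite: Figueroa1995, §3; Roux2014, Thm 29] -/
theorem drDiv_pos {φ ψ : Format} (hE : embedsTest φ ψ = true)
    (hm : 2 * φ.manBits + 1 ≤ ψ.manBits) (hD : ψ.qexp + φ.manBits + 1 ≤ φ.qexp)
    (h1 : 1 ≤ φ.manBits) {a b : MiniFloat φ} (ha : 0 < a.toRat) (hb : 0 < b.toRat) :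
    (roundNE φ (roundNE ψ (a.toRat / b.toRat)).toRat).toRat
      = (roundNE φ (a.toRat / b.toRat)).toRat := by
  by_contra h
  set x := a.toRat / b.toRat with hxdef
  have hx : 0 < x := div_pos ha hb
  have hQφ := φ.quantum_pos; have hQ := ψ.quantum_pos
  have hq1 : ψ.qexp + 1 ≤ φ.qexp := by omega
  have hq : ψ.qexp ≤ φ.qexp := by omega
  obtain ⟨zM, hzM⟩ := exists_toRat_eq_maxRat_of_test hE
  have hmax : φ.maxRat ≤ ψ.maxRat := hzM ▸ (le_abs_self _).trans (abs_toRat_le_maxRat zM)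
  -- the slip anatomy in `φ`: `fl_ψ x = m = (v+u)/2`, `u = v + G`
  obtain ⟨v, u, hv0, hvx, hxu, hgap, hmid, hxm⟩ :=
    slip_midpoint_of_pos_of_qexp_lt (by omega) hq1 hmax hx h
  set y := roundNE ψ x with hydef
  obtain ⟨u', hu'⟩ := exists_toRat_eq_add_ulp hv0 (hvx.trans hxu)
  have hule := add_ulp_le_of_lt hv0 (hvx.trans hxu)
  have hGpos : (0:ℚ) < 2 ^ (v.expCode - 1) * φ.quantum := by positivity
  have hueq : u.toRat = v.toRat + 2 ^ (v.expCode - 1) * φ.quantum := by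
    rcases hgap u' with h1 | h1 <;> linarith
  have hutop : u.toRat ≤ 2 ^ (φ.manBits + 1 + (v.expCode - 1)) * φ.quantum :=
    hueq ▸ toRat_add_ulp_le hv0
  have humax : u.toRat ≤ φ.maxRat := (le_abs_self _).trans (abs_toRat_le_maxRat u)
  have hyu : y.toRat < u.toRat := by rw [hmid]; linarith
  have hy0 : 0 < y.toRat := by rw [hmid]; linarith
  -- quanta: `quantum φ = 2^D quantum ψ`, `ν = quantum ψ / 2`, `2^W ν = 1`
  set D := (φ.qexp - ψ.qexp).toNat with hDdef
  have hDq : φ.quantum = 2 ^ D * ψ.quantum := quantum_eq_two_pow_mul hq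
  have hD1 : φ.manBits + 1 ≤ D := by omega
  set ν : ℚ := ψ.quantum / 2 with hνdef
  have hν : 0 < ν := by positivity
  have hQν : ψ.quantum = 2 * ν := by rw [hνdef]; ring
  have hqψ1 : ψ.qexp ≤ 1 := by unfold Format.qexp; omega
  set W := (1 - ψ.qexp).toNat with hWdef
  have hW0 : ((W : ℕ) : ℤ) = 1 - ψ.qexp := Int.toNat_of_nonneg (by omega)
  have hWν : (2:ℚ) ^ W * ν = 1 := by
    rw [hνdef]; unfold Format.quantum
    rw [← zpow_natCast, hW0, mul_div_assoc', ← zpow_add₀ two_ne_zero, sub_add_cancel, zpow_one,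
      div_self two_ne_zero]
  -- the midpoint in units of `ν`: `m = M ν`, `M = (2V'+1) 2^g`, `v = 2V' 2^g ν`
  have hyQ : y.toRat = (y.scaledMag : ℚ) * ψ.quantum := by
    rw [toRat_eq_toInt_mul, toInt_eq_scaledMag_of_nonneg hy0.le]; push_cast; rfl
  have hvQ : v.toRat = (v.scaledMag : ℚ) * φ.quantum := by
    rw [toRat_eq_toInt_mul, toInt_eq_scaledMag_of_nonneg hv0]; push_cast; rfl
  obtain ⟨V', hV'⟩ := pow_ulpExp_dvd_scaledMag v
  set g := (v.expCode - 1) + D with hgdef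
  set M : ℤ := 2 * (y.scaledMag : ℤ) with hMdef
  have hmν : y.toRat = (M : ℚ) * ν := by rw [hyQ, hMdef, hQν]; push_cast; ring
  have hGν : 2 ^ (v.expCode - 1) * φ.quantum = 2 * (2:ℚ) ^ g * ν := by
    rw [hDq, hQν, hgdef, pow_add]; ring
  have hMg : M = (2 * (V' : ℤ) + 1) * 2 ^ g := by
    have h1 : (M : ℚ) * ν = ((2 * (V' : ℤ) + 1) * 2 ^ g : ℤ) * ν := by
      rw [← hmν, hmid, hueq, hvQ, hV', hGν, hDq, hQν, hgdef]
      push_cast; ring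
    exact_mod_cast mul_right_cancel₀ (ne_of_gt hν) h1
  have hvν : v.toRat = 2 * (V' : ℚ) * 2 ^ g * ν := by
    rw [hvQ, hV', hDq, hQν, hgdef]; push_cast; ring
  -- (a) correct rounding in `ψ`: `|x - m| ≤ 2^t ν`, for a normal or subnormal `m`
  set t := y.expCode - 1 with htdef
  have hyz : y.toRat < zM.toRat := by rw [hzM]; linarith
  have habs : |x - y.toRat| ≤ 2 ^ t * ν := by
    have := abs_sub_roundNE_le_half_ulp_of_pos hy0 hyz
    rw [← hydef, hQν] at this; convert this using 1; rw [htdef]; ring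
  -- (b) binade bookkeeping: `g ≥ t + P_φ`
  have hMlt : M < (2:ℤ) ^ (φ.manBits + 1 + g + 1) := by
    have h1 : (M : ℚ) * ν < (2:ℚ) ^ (φ.manBits + 1 + g + 1) * ν := by
      rw [← hmν]
      calc y.toRat < u.toRat := hyu
        _ ≤ 2 ^ (φ.manBits + 1 + (v.expCode - 1)) * φ.quantum := hutop
        _ = (2:ℚ) ^ (φ.manBits + 1 + g + 1) * ν := by
            rw [hDq, hQν, hgdef]; simp only [pow_add, pow_one]; ring
    exact_mod_cast lt_of_mul_lt_mul_right h1 hν.le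
  have hg : t + (φ.manBits + 1) ≤ g := by
    rcases Nat.lt_or_ge y.expCode 1 with hE0 | hE1
    · have : t = 0 := by omega
      omega
    · have hSy_lo : 2 ^ (ψ.manBits + t) ≤ y.scaledMag := pow_le_scaledMag_of_expCode_pos y hE1
      have hMge : (2:ℤ) ^ (ψ.manBits + t + 1) ≤ M := by
        have h1 : ((2 ^ (ψ.manBits + t) : ℕ) : ℤ) ≤ y.scaledMag := by exact_mod_cast hSy_lo
        push_cast at h1
        rw [hMdef, pow_succ]; linarith
      have := (pow_lt_pow_iff_right₀ (by norm_num : (1:ℤ) < 2)).mp (hMge.trans_lt hMlt)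
      omega
  -- (c) the significands: `a = 2^α A₁ q`, `b = 2^β B₁ q`, odd parts below `2^P_φ`
  have haS : a.scaledMag ≠ 0 := by
    intro h0; rw [toRat_eq_toInt_mul, toInt_eq_scaledMag_of_nonneg ha.le, h0] at ha; simp at ha
  have hbS : b.scaledMag ≠ 0 := by
    intro h0; rw [toRat_eq_toInt_mul, toInt_eq_scaledMag_of_nonneg hb.le, h0] at hb; simp at hb
  obtain ⟨α, A₁, hA₁, hAα, hA₁lt⟩ := exists_odd_part a haS
  obtain ⟨β, B₁, hB₁, hBβ, hB₁lt⟩ := exists_odd_part b hbS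
  have hAq : a.toRat = (2:ℚ) ^ α * A₁ * φ.quantum := by
    rw [toRat_eq_toInt_mul, toInt_eq_scaledMag_of_nonneg ha.le, hAα]; push_cast; ring
  have hBq : b.toRat = (2:ℚ) ^ β * B₁ * φ.quantum := by
    rw [toRat_eq_toInt_mul, toInt_eq_scaledMag_of_nonneg hb.le, hBβ]; push_cast; ring
  have hden : (0:ℚ) < 2 ^ β * B₁ := by
    have : 0 < B₁ := hB₁.pos
    positivity
  have hxAB : x = (2:ℚ) ^ α * A₁ / (2 ^ β * B₁) := by
    rw [hxdef, hAq, hBq, mul_div_mul_right _ _ (ne_of_gt hQφ)]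
  have hBx : (2:ℚ) ^ β * B₁ * x = 2 ^ α * A₁ := by
    rw [hxAB, ← mul_div_assoc, mul_comm (2 ^ β * (B₁ : ℚ)) (2 ^ α * A₁), mul_div_assoc,
      div_self (ne_of_gt hden), mul_one]
  -- (d) the integer `N = B (x - m) / ν`
  set N : ℤ := (2:ℤ) ^ (α + W) * A₁ - (2 * V' + 1) * 2 ^ (g + β) * B₁ with hNdef
  have hNν : (N : ℚ) * ν = 2 ^ β * B₁ * (x - y.toRat) := by
    have e1 : (N : ℚ) * ν = 2 ^ α * A₁ * (2 ^ W * ν) - 2 ^ β * B₁ * ((M : ℚ) * ν) := by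
      rw [hNdef, hMg]; push_cast; rw [pow_add, pow_add]; ring
    rw [e1, hWν, ← hmν, mul_sub, hBx]; ring
  have hN0 : N ≠ 0 := by
    intro h0
    have h1 : (2:ℚ) ^ β * B₁ * (x - y.toRat) = 0 := by rw [← hNν, h0]; simp
    rcases mul_eq_zero.mp h1 with h2 | h2
    · exact absurd h2 (ne_of_gt hden)
    · exact hxm (sub_eq_zero.mp h2)
  have hNle : |N| ≤ (2:ℤ) ^ (t + β) * B₁ := by
    have h1 : |(N : ℚ)| * ν ≤ ((2:ℚ) ^ (t + β) * B₁) * ν := by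
      have e : |(N : ℚ)| * ν = 2 ^ β * B₁ * |x - y.toRat| := by
        rw [← abs_of_pos hν, ← abs_mul, hNν, abs_mul, abs_of_pos hden]
      rw [e]
      calc 2 ^ β * (B₁ : ℚ) * |x - y.toRat| ≤ 2 ^ β * B₁ * (2 ^ t * ν) :=
            mul_le_mul_of_nonneg_left habs hden.le
        _ = 2 ^ (t + β) * B₁ * ν := by rw [pow_add]; ring
    have h2 := le_of_mul_le_mul_right h1 hν
    rw [← Int.cast_abs] at h2
    exact_mod_cast h2
  -- (e) `2^g ν < x` (else `v = 0`, `x < m = quantum_φ / 2` and both routes give `0`)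
  have hmxQ : (2:ℚ) ^ g * ν < x := by
    rcases Nat.eq_zero_or_pos V' with hV0 | hVpos
    · have hv00 : v.toRat = 0 := by rw [hvν, hV0]; simp
      have hvS : v.scaledMag = 0 := by rw [hV', hV0, mul_zero]
      have hve : v.expCode - 1 = 0 := by
        rcases Nat.lt_or_ge v.expCode 1 with h0 | h1'
        · omega
        · exfalso
          have h2 := pow_le_scaledMag_of_expCode_pos v h1'
          rw [hvS] at h2
          exact absurd h2 (not_le.mpr (by positivity))
      have hm' : y.toRat = (2:ℚ) ^ g * ν := by rw [hmν, hMg, hV0]; push_cast; ring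
      have hmq : y.toRat = φ.quantum / 2 := by
        rw [hmid, hueq, hv00, hve, pow_zero, one_mul]; ring
      by_contra hle
      have hxy : x < y.toRat := lt_of_le_of_ne (by rw [hm']; exact not_lt.mp hle) hxm
      have hxq : x < φ.quantum / 2 := by rw [← hmq]; exact hxy
      apply h
      rw [toRat_roundNE_eq_zero_of_abs_le_half h1 (by rw [hmq, abs_of_pos (by positivity)]),
        toRat_roundNE_eq_zero_of_abs_le_half h1 (by rw [abs_of_pos hx]; exact hxq.le)]
    · have h1' : (1:ℚ) ≤ V' := by exact_mod_cast hVpos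
      have hp : (0:ℚ) < 2 ^ g * ν := by positivity
      have h2 : (2:ℚ) ^ g * ν ≤ v.toRat := by
        calc (2:ℚ) ^ g * ν = 1 * (2 ^ g * ν) := by ring
          _ ≤ (2 * V') * (2 ^ g * ν) := mul_le_mul_of_nonneg_right (by linarith) hp.le
          _ = v.toRat := by rw [hvν]; ring
      exact h2.trans_lt hvx
  have hmx : (2:ℤ) ^ (g + β) * B₁ < 2 ^ (α + W) * A₁ := by
    have h2 : (2:ℚ) ^ g * ν * (2 ^ β * B₁) < 2 ^ α * A₁ := by
      calc (2:ℚ) ^ g * ν * (2 ^ β * B₁) < x * (2 ^ β * B₁) := mul_lt_mul_of_pos_right hmxQ hden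
        _ = 2 ^ α * A₁ := by rw [mul_comm, hBx]
    have h3 : (2:ℚ) ^ (g + β) * B₁ < 2 ^ (α + W) * A₁ := by
      calc (2:ℚ) ^ (g + β) * B₁ = 2 ^ (g + β) * B₁ * (2 ^ W * ν) := by rw [hWν, mul_one]
        _ = 2 ^ g * ν * (2 ^ β * B₁) * 2 ^ W := by rw [pow_add]; ring
        _ < 2 ^ α * A₁ * 2 ^ W := mul_lt_mul_of_pos_right h2 (by positivity)
        _ = 2 ^ (α + W) * A₁ := by rw [pow_add]; ring
    exact_mod_cast h3
  exact div_slip_core (p := φ.manBits + 1) hA₁ hA₁lt hB₁lt hg hN0 hNle hmx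

/-- THEOREM D-div, THE QUOTIENT CLAUSE (Q), every pair of format records: `F_φ ⊆ F_ψ`,
`P_ψ ≥ 2 P_φ`, `L_ψ + P_φ ≤ L_φ` and `m_φ ≥ 1` imply that ONE division of `φ`-data executed in `ψ`
and converted to `φ` is the correctly rounded quotient of `φ` (signs by the oddness of `roundNE`,
`a = 0` or `b = 0` give `0`). Named cells: `DoubleRoundingDivisionMatrix.lean`;
A = `code/enum/doublediv_decision.py`. [this packet; cite: Figueroa1995, §3; Roux2014, Thm 29] -/
theorem drDiv_of_clause {φ ψ : Format} (hE : embedsTest φ ψ = true)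
    (hm : 2 * φ.manBits + 1 ≤ ψ.manBits) (hD : ψ.qexp + φ.manBits + 1 ≤ φ.qexp)
    (h1 : 1 ≤ φ.manBits) :
    ∀ a b : MiniFloat φ, (roundNE φ (roundNE ψ (a.toRat / b.toRat)).toRat).toRat
      = (roundNE φ (a.toRat / b.toRat)).toRat := by
  intro a b
  by_cases ha0 : a.toRat = 0
  · simp only [ha0, zero_div, toRat_roundNE_zero]
  by_cases hb0 : b.toRat = 0
  · simp only [hb0, div_zero, toRat_roundNE_zero]
  have negx : ∀ x : ℚ, (roundNE φ (roundNE ψ (-x)).toRat).toRat = (roundNE φ (-x)).toRat ↔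
      (roundNE φ (roundNE ψ x).toRat).toRat = (roundNE φ x).toRat := by
    intro x; rw [toRat_roundNE_neg, toRat_roundNE_neg, toRat_roundNE_neg, neg_inj]
  rcases lt_or_gt_of_ne ha0 with ha | ha <;> rcases lt_or_gt_of_ne hb0 with hb | hb
  · have key := drDiv_pos hE hm hD h1 (a := a.flipSign) (b := b.flipSign)
      (by simp only [toRat_flipSign]; linarith) (by simp only [toRat_flipSign]; linarith)
    simpa only [toRat_flipSign, neg_div_neg_eq] using key
  · have key := drDiv_pos hE hm hD h1 (a := a.flipSign) (b := b)
      (by simp only [toRat_flipSign]; linarith) hb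
    simp only [toRat_flipSign, neg_div] at key
    exact (negx _).mp key
  · have key := drDiv_pos hE hm hD h1 (a := a) (b := b.flipSign)
      ha (by simp only [toRat_flipSign]; linarith)
    simp only [toRat_flipSign, div_neg] at key
    exact (negx _).mp key
  · exact drDiv_pos hE hm hD h1 ha hb

end Summit.Ventures.CertifiedArithmetic
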